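import Literature.AlgebraicGeometry.Motives.MumfordTateInvariantsDualForm
import Literature.AlgebraicGeometry.Motives.MumfordTateInvariantsHodgeBasis
import Literature.AlgebraicGeometry.Motives.HodgeTensorDualOpposedProofs
import Literature.AlgebraicGeometry.Motives.HodgeTensorProofs
import Literature.AlgebraicGeometry.Motives.MumfordTateInvariantsTorusNorm
import HarnessLib

/-!
# The polarization form of `T^{a,b}` in an orthonormal graded tensor basis (Mumford–Tate invariants, step 16)

For a polarization `Q` of `H` (pure weight `n`, `V` finite-dimensional) the induced form on
`T^{a,b} = V^{⊗a} ⊗ (V^∨)^{⊗b}` is `Q_T = Q^{⊗a} ⊗ (Q^∨)^{⊗b}` (`Polarization.tensorForm`,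
from `tensorForm` and the inverse form `Polarization.dualForm`). In the tensor basis
`E = hodgeTensorBasisBC e a b` of `ℂ ⊗ T^{a,b}` attached to an `h`-orthonormal graded basis `e` of
`V_ℂ` (`Polarization.exists_orthonormal_graded_basis`) we compute its complexification `Q_{T,ℂ}`:

* `conj_hodgeTensorBasisBC` — complex conjugation of the basis vectors:
  `conj (E (β, γ)) = ι⁻¹ ((⊗ conj (e βₖ)) ⊗ (⊗ conjDual (e^∨ γₗ)))`;
* `Polarization.tensorFormC_basis_basis` — `Q_{T,ℂ}(E x, E y) = 0` unless
  `tensorDegree x + tensorDegree y = (a - b) n` (first Hodge–Riemann relation in coordinates);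
* `Polarization.tensorFormC_basis_conj_basis` — `Q_{T,ℂ}(E x, conj (E y)) = δ_{xy} d_x` with
  `hodgeSign ((a-b) n) (tensorDegree x) · d_x = 1` (`hodgeSign_mul_tensorSign`): the second
  Hodge–Riemann relation in coordinates.

These are the basis computations behind "`Q` induces a polarization of every `T^{a,b}`"
(Deligne, *Théorie de Hodge II*, 2.1.15; Green–Griffiths–Kerr (I.B.6)), assembled in
`MumfordTateInvariantsTensorPolarization.lean`.

## References

* P. Deligne, *Théorie de Hodge II*, Publ. Math. IHÉS 40 (1971), 1.1.12, 2.1.15.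
* M. Green, P. Griffiths, M. Kerr, *Mumford–Tate groups and domains* (2012), (I.B.6).
-/

noncomputable section

open scoped TensorProduct
open PiTensorProduct Complex

namespace Literature.AlgebraicGeometry.Motives

namespace HodgeStructure

universe u

variable {V : Type u} [AddCommGroup V] [Module ℚ V] [Module.Finite ℚ V] {n : ℤ}

/-! ### Complex conjugation through the comparison isomorphism -/

omit [Module.Finite ℚ V] in
/-- `dualBaseChange` intertwines `conj` on `ℂ ⊗ V^∨` with `conjDual` on `(V_ℂ)^∨`. [folklore] -/
theorem dualBaseChange_conj_eq_conjDual (ξ : ℂ ⊗[ℚ] Module.Dual ℚ V) :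
    dualBaseChange V (conj ξ) = conjDual (dualBaseChange V ξ) := by
  refine LinearMap.ext fun x => ?_
  rw [dualBaseChange_conj, conjDual_apply]

/-- **Complex conjugation of pure tensors through `ι`**:
`ι (conj (ι⁻¹ ((⊗vₖ) ⊗ (⊗φₗ)))) = (⊗ conj vₖ) ⊗ (⊗ conjDual φₗ)`. [folklore] -/
theorem hodgeTensorSpaceBaseChange_conj_symm_tprod {a b : ℕ} (v : Fin a → ℂ ⊗[ℚ] V)
    (φ : Fin b → Module.Dual ℂ (ℂ ⊗[ℚ] V)) :
    hodgeTensorSpaceBaseChange V a b (conj ((hodgeTensorSpaceBaseChange V a b).symm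
        (tprod ℂ v ⊗ₜ[ℂ] tprod ℂ φ))) =
      (tprod ℂ fun k => conj (v k)) ⊗ₜ[ℂ] tprod ℂ fun l => conjDual (φ l) := by
  set m₁ := (piTensorBaseChangeEquiv V (Fin a)).symm (tprod ℂ v) with hm₁
  have h₁ : piTensorBaseChange V (Fin a) m₁ = tprod ℂ v := by
    rw [← piTensorBaseChangeEquiv_apply, hm₁, LinearEquiv.apply_symm_apply]
  set φ' : Fin b → ℂ ⊗[ℚ] Module.Dual ℚ V := fun l => (dualBaseChangeEquiv V).symm (φ l) with hφ'
  set m₂ := (piTensorBaseChangeEquiv (Module.Dual ℚ V) (Fin b)).symm (tprod ℂ φ') with hm₂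
  have h₂ : piTensorBaseChange (Module.Dual ℚ V) (Fin b) m₂ = tprod ℂ φ' := by
    rw [← piTensorBaseChangeEquiv_apply, hm₂, LinearEquiv.apply_symm_apply]
  have hι : ∀ z, hodgeTensorSpaceBaseChange V a b
      ((tensorBaseChange (⨂[ℚ]^a V) (⨂[ℚ]^b (Module.Dual ℚ V))).symm z) =
      TensorProduct.congr (piTensorBaseChangeEquiv V (Fin a))
        ((piTensorBaseChangeEquiv (Module.Dual ℚ V) (Fin b)).trans
          (PiTensorProduct.congr fun _ => dualBaseChangeEquiv V)) z := fun z => by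
    simp only [hodgeTensorSpaceBaseChange, LinearEquiv.trans_apply, LinearEquiv.apply_symm_apply]
  have hsymm : (hodgeTensorSpaceBaseChange V a b).symm (tprod ℂ v ⊗ₜ[ℂ] tprod ℂ φ) =
      (tensorBaseChange (⨂[ℚ]^a V) (⨂[ℚ]^b (Module.Dual ℚ V))).symm (m₁ ⊗ₜ[ℂ] m₂) := by
    rw [LinearEquiv.symm_apply_eq, hι, TensorProduct.congr_tmul, LinearEquiv.trans_apply,
      piTensorBaseChangeEquiv_apply, h₁, piTensorBaseChangeEquiv_apply, h₂,
      PiTensorProduct.congr_tprod]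
    simp [hφ']
  rw [hsymm, conj_tensorBaseChange_symm_tmul, hι, TensorProduct.congr_tmul,
    LinearEquiv.trans_apply, piTensorBaseChangeEquiv_apply, piTensorBaseChange_conj_of_eq_tprod h₁,
    piTensorBaseChangeEquiv_apply, piTensorBaseChange_conj_of_eq_tprod h₂,
    PiTensorProduct.congr_tprod]
  congr 2
  ext l
  rw [dualBaseChangeEquiv_apply, dualBaseChange_conj_eq_conjDual, hφ', ← dualBaseChangeEquiv_apply,
    LinearEquiv.apply_symm_apply]

variable {S : Type u} [Fintype S] [DecidableEq S] {deg : S → ℤ}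

/-- **Complex conjugation of the tensor basis vectors of `ℂ ⊗ T^{a,b}`**:
`conj (E (β, γ)) = ι⁻¹ ((⊗ conj (e βₖ)) ⊗ (⊗ conjDual (e^∨ γₗ)))`. [folklore] -/
theorem conj_hodgeTensorBasisBC (e : Module.Basis S ℂ (ℂ ⊗[ℚ] V)) {a b : ℕ}
    (x : (Fin a → S) × (Fin b → S)) :
    conj (hodgeTensorBasisBC e a b x) = (hodgeTensorSpaceBaseChange V a b).symm
      ((tprod ℂ fun k => conj (e (x.1 k))) ⊗ₜ[ℂ] tprod ℂ fun l => conjDual (e.dualBasis (x.2 l))) := by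
  rw [eq_comm, LinearEquiv.symm_apply_eq, hodgeTensorBasisBC, Module.Basis.map_apply,
    hodgeTensorBasis_apply, hodgeTensorSpaceBaseChange_conj_symm_tprod]

/-! ### The induced form on `T^{a,b}` and its values on the tensor basis -/

/-- **The induced polarization form on `T^{a,b}`**: `Q_T = Q^{⊗a} ⊗ (Q^∨)^{⊗b}`. [folklore] -/
def Polarization.tensorForm {H : HodgeStructure V n} (Q : Polarization H) (a b : ℕ) :
    LinearMap.BilinForm ℚ (hodgeTensorSpace V a b) :=
  Motives.tensorForm Q.form Q.dualForm a b

/-- `Q_{T,ℂ}` on the tensor basis: the product formula. [folklore] -/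
theorem Polarization.tensorFormC_basis_apply {H : HodgeStructure V n} (Q : Polarization H)
    (e : Module.Basis S ℂ (ℂ ⊗[ℚ] V)) {a b : ℕ} (x : (Fin a → S) × (Fin b → S))
    (v : Fin a → ℂ ⊗[ℚ] V) (φ : Fin b → Module.Dual ℂ (ℂ ⊗[ℚ] V)) :
    (Q.tensorForm a b).baseChange ℂ (hodgeTensorBasisBC e a b x)
        ((hodgeTensorSpaceBaseChange V a b).symm (tprod ℂ v ⊗ₜ[ℂ] tprod ℂ φ)) =
      (∏ k, Q.form.baseChange ℂ (e (x.1 k)) (v k)) *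
        ∏ l, dualFormBaseChange V Q.dualForm (e.dualBasis (x.2 l)) (φ l) := by
  rw [Polarization.tensorForm, tensorForm_baseChange, hodgeTensorSpaceBaseChange_hodgeTensorBasisBC,
    LinearEquiv.apply_symm_apply, hodgeTensorBasis_apply, tensorForm_tmul_tprod]

/-- **First Hodge–Riemann relation in coordinates**: for a graded `h`-orthonormal basis,
`Q_{T,ℂ}(E x, E y) = 0` unless `tensorDegree x + tensorDegree y = (a - b) n`. [folklore] -/
theorem Polarization.tensorFormC_basis_basis {H : HodgeStructure V n} (Q : Polarization H)
    (e : Module.Basis S ℂ (ℂ ⊗[ℚ] V))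
    (hon : ∀ σ τ, Q.form.baseChange ℂ (e σ) (conj (e τ)) =
      if σ = τ then (hodgeSign n (deg σ))⁻¹ else 0)
    (he : ∀ σ, e σ ∈ H.piece (deg σ) (n - deg σ)) {a b : ℕ} {x y : (Fin a → S) × (Fin b → S)}
    (hxy : tensorDegree deg x + tensorDegree deg y ≠ ((a : ℤ) - b) * n) :
    (Q.tensorForm a b).baseChange ℂ (hodgeTensorBasisBC e a b x) (hodgeTensorBasisBC e a b y) = 0 := by
  have hy : hodgeTensorBasisBC e a b y = (hodgeTensorSpaceBaseChange V a b).symm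
      (tprod ℂ (fun k => e (y.1 k)) ⊗ₜ[ℂ] tprod ℂ fun l => e.dualBasis (y.2 l)) := by
    rw [hodgeTensorBasisBC, Module.Basis.map_apply, hodgeTensorBasis_apply]
  rw [hy, Q.tensorFormC_basis_apply]
  -- if the product were non-zero, every factor would be, forcing the degree identity
  by_contra hne
  obtain ⟨h1, h2⟩ := mul_ne_zero_iff.1 hne
  rw [Finset.prod_ne_zero_iff] at h1 h2
  apply hxy
  have hk : ∀ k, deg (x.1 k) + deg (y.1 k) = n := fun k => by
    by_contra hk
    exact h1 k (Finset.mem_univ _) (Q.form_piece_piece hk (he _) (he _))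
  have hl : ∀ l, deg (x.2 l) + deg (y.2 l) = n := fun l => by
    by_contra hl
    exact h2 l (Finset.mem_univ _) (Q.dualFormC_dualBasis_dualBasis e hon he hl)
  simp only [tensorDegree_apply]
  have h3 : ∑ k, (deg (x.1 k) + deg (y.1 k)) = ∑ _k : Fin a, n := Finset.sum_congr rfl fun k _ => hk k
  have h4 : ∑ l, (deg (x.2 l) + deg (y.2 l)) = ∑ _l : Fin b, n := Finset.sum_congr rfl fun l _ => hl l
  rw [Finset.sum_add_distrib] at h3 h4
  simp only [Finset.sum_const, Finset.card_univ, Fintype.card_fin] at h3 h4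
  linear_combination h3 - h4

/-- **Second Hodge–Riemann relation in coordinates**: for a graded `h`-orthonormal basis,
`Q_{T,ℂ}(E x, conj (E y)) = δ_{xy} · (∏ₖ (hodgeSign n (deg βₖ))⁻¹)(∏ₗ hodgeSign n (deg γₗ))`.
[folklore] -/
theorem Polarization.tensorFormC_basis_conj_basis {H : HodgeStructure V n} (Q : Polarization H)
    (e : Module.Basis S ℂ (ℂ ⊗[ℚ] V))
    (hon : ∀ σ τ, Q.form.baseChange ℂ (e σ) (conj (e τ)) =
      if σ = τ then (hodgeSign n (deg σ))⁻¹ else 0)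
    {a b : ℕ} (x y : (Fin a → S) × (Fin b → S)) :
    (Q.tensorForm a b).baseChange ℂ (hodgeTensorBasisBC e a b x) (conj (hodgeTensorBasisBC e a b y)) =
      if x = y then (∏ k, (hodgeSign n (deg (x.1 k)))⁻¹) * ∏ l, hodgeSign n (deg (x.2 l)) else 0 := by
  rw [conj_hodgeTensorBasisBC, Q.tensorFormC_basis_apply]
  simp_rw [hon, Q.dualFormC_dualBasis_conjDual e hon]
  by_cases hxy : x = y
  · subst hxy
    simp
  · rw [if_neg hxy]
    -- some index differs
    have h : (∃ k, x.1 k ≠ y.1 k) ∨ ∃ l, x.2 l ≠ y.2 l := by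
      by_contra hall
      simp only [not_or, not_exists, not_not] at hall
      exact hxy (Prod.ext (funext hall.1) (funext hall.2))
    rcases h with ⟨k, hk⟩ | ⟨l, hl⟩
    · rw [Finset.prod_eq_zero (Finset.mem_univ k) (by rw [if_neg hk]), zero_mul]
    · rw [Finset.prod_eq_zero (Finset.mem_univ l) (by rw [if_neg hl]), mul_zero]

/-! ### The sign bookkeeping -/

omit [Module.Finite ℚ V] in
/-- `i^p / i^{n-p} = i^{2p-n}`. [folklore] -/
theorem hodgeSign_eq_zpow (n p : ℤ) : hodgeSign n p = Complex.I ^ (2 * p - n) := by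
  rw [hodgeSign, ← zpow_neg, ← zpow_add₀ I_ne_zero]
  congr 1
  ring

omit [Module.Finite ℚ V] [Fintype S] [DecidableEq S] in
/-- **The signs cancel on the Hodge pieces of `T^{a,b}`**:
`hodgeSign ((a-b) n) (tensorDegree x) · (∏ₖ (hodgeSign n (deg βₖ))⁻¹)(∏ₗ hodgeSign n (deg γₗ)) = 1`.
[folklore] -/
theorem hodgeSign_mul_tensorSign (deg : S → ℤ) {a b : ℕ} (x : (Fin a → S) × (Fin b → S)) :
    hodgeSign (((a : ℤ) - b) * n) (tensorDegree deg x) *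
      ((∏ k, (hodgeSign n (deg (x.1 k)))⁻¹) * ∏ l, hodgeSign n (deg (x.2 l))) = 1 := by
  simp_rw [hodgeSign_eq_zpow, ← zpow_neg]
  rw [prod_zpow_eq_zpow_sum _ _ I_ne_zero, prod_zpow_eq_zpow_sum _ _ I_ne_zero,
    ← zpow_add₀ I_ne_zero, ← zpow_add₀ I_ne_zero]
  have h : 2 * tensorDegree deg x - ((a : ℤ) - b) * n +
      (∑ k, -(2 * deg (x.1 k) - n) + ∑ l, (2 * deg (x.2 l) - n)) = 0 := by
    simp only [tensorDegree_apply, Finset.sum_neg_distrib, Finset.sum_sub_distrib,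
      Finset.sum_const, Finset.card_univ, Fintype.card_fin, ← Finset.mul_sum]
    ring
  rw [h, zpow_zero]

end HodgeStructure

end Literature.AlgebraicGeometry.Motives

end
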